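import Summits.QuantumFields.YangMills.Theorems.BalabanLadderNTMarkovMirror
import HarnessLib

/-!
# Crux `NT` (stmt-QuantumFields-19353) / `UVSeamRec.stub_floorsEngine` (stmt-QuantumFields-20043):
# the Markov MIRROR factorisation (card `markov-mirror-dirichlet-response`, X2 in reflection geometry)

Sequel of `…NTMarkovMirror.lean` (fleet lead prover of crux `UVSeamRec`, unit `ym-spine-20043-p1`, g6).  For a cube
`Q = (c, b)` of `ℤ⁴` at times `≥ 1` and its time reflection `Θ₀Q` (`Θ₀ = cfgReflect`, the site reflection
`(t, x⃗) ↦ (−t, x⃗)` with temporal links reversed and inverted; `lift ∘ ϑ = Θ₀ ∘ lift` for the torus site reflection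
`ϑ = GaugeConfig.negReflect`, tree `torusLift_negReflect`), and bounded continuous cylinder observables `F₁`, `F₂`
carried by `Q`:

* `integral_reflect_lift_mul_lift_eq` — `E_T[F₁∘lift∘ϑ · F₂∘lift] = E_T[kerE_Q(F₁)∘lift∘ϑ · kerE_Q(F₂)∘lift]`
  (general torus side `T`, window form);
* `torusCov_reflect_lift_eq_torusCov_reflect_kerE` — the covariance form on odd tori in the `torusE` vocabulary of the
  route Defs: `Cov_T(F₁∘Θ₀, F₂) = Cov_T(kerE_Q(F₁)∘Θ₀, kerE_Q(F₂))`.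

With `F₁ = F₂ = Ṽ_v` (the smeared action density carried by one positive-time femto cube) and lattice reflection
positivity, the right-hand side is the squared Osterwalder–Schrader seminorm `‖kerE_Q(Ṽ)∘lift‖²_OS` of ONE cube's
boundary response — the re-typing of clause (i) of `LowerBounds` proposed by card E.  Mechanism: the reflected
observable `F₁∘Θ₀` and the reflected boundary response `kerE_Q(F₁)∘Θ₀` are cylinders at times `≤ 0`, hence exterior
spectators for `Q` (`integral_mul_lift_eq_integral_mul_kerE`), and Wilson's torus measure is `ϑ`-invariant on every
torus (`integral_comp_negReflect_eq`).

Refs: K. Osterwalder, E. Seiler, Ann. Phys. 110 (1978) 440, §2; E. Seiler, LNP 159 (1982) Ch. 2; H.-O. Georgii (2011)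
Rem. 1.24; crux idea `Cruxes/NT/Ideas/markov-mirror-dirichlet-response.md` (Mechanism 1, Lever).
-/

set_option autoImplicit false

noncomputable section

open MeasureTheory Filter Topology
open Literature.MathematicalPhysics.QuantumFieldTheory Literature.MathematicalPhysics.QuantumLattice
open Literature.Probability.LatticeModels
open Summit.QuantumFields.YangMills.Cruxes.OSLegsFromFemtoAndGap.DlrCollarTransfer
open Summit.QuantumFields.YangMills.Cruxes.OSLegsFromFemtoAndGap.DlrCollarTransfer.StubLower
  (isCylinder_mul mem_cubeSites_iff)
open Summit.QuantumFields.YangMills.Theorems.OSLegsFromFemtoAndGap.StubLower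
  (integral_torusLift_eq_integral_kernel exists_near_of_mem_plaquetteEdges_touching)
open Summit.QuantumFields.YangMills.Cruxes.NT.Reference (continuous_kerE continuous_kerE_torusLift abs_mul_le_of_abs_le)
open Summit.QuantumFields.YangMills.Cruxes.NT.BoundaryLaw (abs_kerE_le)
open Summit.QuantumFields.YangMills.Cruxes.OSLegsAtWeakCouplingC.InheritedAmplitudeGates.StubInherit
  (integral_lift_eq_integral_kerE_cube)

namespace Summit.QuantumFields.YangMills.Cruxes.NT.MarkovMirror

section Reflect

variable (G : Type) [Group G] [TopologicalSpace G] [IsTopologicalGroup G] [CompactSpace G]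
  [MeasurableSpace G] [BorelSpace G] (r : LatticeRep G)

/-! ## §4 The mirror form: a cube at positive times against its time reflection -/

/-- **Mirror factorisation (the lever of card E).**  A cube `Q = (c, b)` at times `≥ 1` (`1 ≤ c 0`) inside a
coordinate window of the torus of side `T` that also holds its time reflection `Θ₀Q` (`lo 0 + c 0 + b + 3 ≤ 0`);
bounded continuous cylinder observables `F₁`, `F₂` with links based in `[c, c + b]`.  Then, with `ϑ` the torus site
reflection `GaugeConfig.negReflect` (so that `lift ∘ ϑ = Θ₀ ∘ lift`, `torusLift_negReflect`),
`E_T[F₁∘lift∘ϑ · F₂∘lift] = E_T[kerE_Q(F₁)∘lift∘ϑ · kerE_Q(F₂)∘lift]`: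
the reflected observable `F₁∘Θ₀` and the reflected boundary response `kerE_Q(F₁)∘Θ₀` are cylinders at times `≤ 0`,
hence exterior spectators for `Q`; pull `F₂` through `Q`, reflect (`integral_comp_negReflect_eq`), pull `F₁`
through `Q`, reflect back. [folklore] -/
theorem integral_reflect_lift_mul_lift_eq (β : ℝ) (c : Fin 4 → ℤ) (b T : ℕ) [NeZero T] (lo : Fin 4 → ℤ)
    (hc0 : 1 ≤ c 0) (hc : ∀ j, lo j + 2 ≤ c j ∧ c j + (b : ℤ) + 2 ≤ lo j + T)
    (hlo : lo 0 + c 0 + (b : ℤ) + 3 ≤ 0)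
    {F₁ F₂ : LGConfig 4 G → ℝ} (hF₁ : Continuous F₁) (hF₂ : Continuous F₂) {M₁ M₂ : ℝ}
    (hM₁ : ∀ U, |F₁ U| ≤ M₁) (hM₂ : ∀ U, |F₂ U| ≤ M₂)
    {S₁ S₂ : Finset (Literature.MathematicalPhysics.QuantumLattice.ZdEdge 4)}
    (hS₁ : IsCylinder F₁ S₁) (hS₂ : IsCylinder F₂ S₂)
    (hW₁ : ∀ e ∈ S₁, ∀ j, c j ≤ e.1 j ∧ e.1 j ≤ c j + b)
    (hW₂ : ∀ e ∈ S₂, ∀ j, c j ≤ e.1 j ∧ e.1 j ≤ c j + b) :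
    ∫ U, F₁ (torusLift T U.negReflect) * F₂ (torusLift T U) ∂(wilsonMeasure (d := 4) (L := T) r.ρ β) =
      ∫ U, kerE G r β c b (torusLift T U.negReflect) F₁ * kerE G r β c b (torusLift T U) F₂
        ∂(wilsonMeasure (d := 4) (L := T) r.ρ β) := by
  classical
  haveI := r.secondCountableTopology
  have hc' : ∀ j, lo j + 1 ≤ c j ∧ c j + (b : ℤ) + 2 ≤ lo j + T := fun j => ⟨by linarith [(hc j).1], (hc j).2⟩
  -- windows of reflected supports: a set of links based in `[c − 1, c + b]` reflects into the window, off `Q`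
  have hoff : ∀ {S : Finset (Literature.MathematicalPhysics.QuantumLattice.ZdEdge 4)},
      (∀ e ∈ S, ∀ j, c j - 1 ≤ e.1 j ∧ e.1 j ≤ c j + b) →
      (∀ e ∈ S.image reflectEdge, e ∉ cubeEdges c b) ∧
      (∀ e ∈ S.image reflectEdge, ∀ j, lo j + 1 ≤ e.1 j ∧ e.1 j + 2 ≤ lo j + T) := by
    intro S hS
    have h0 : ∀ e ∈ S, c 0 - 1 ≤ e.1 0 ∧ e.1 0 ≤ c 0 + b := fun e he => hS e he 0
    refine ⟨fun e he hcub => ?_, fun e he j => ?_⟩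
    · obtain ⟨ht1, ht2, -⟩ := reflect_window h0 he
      have := cubeEdges_fst_window hcub 0
      linarith [this.1]
    · obtain ⟨ht1, ht2, hsp⟩ := reflect_window h0 he
      by_cases hj : j = 0
      · subst hj
        have := hc 0
        constructor <;> linarith
      · obtain ⟨e', he', hee'⟩ := hsp j hj
        rw [hee']
        have := hS e' he' j
        have := hc j
        constructor <;> linarith
  have hW₁' : ∀ e ∈ S₁, ∀ j, c j - 1 ≤ e.1 j ∧ e.1 j ≤ c j + b :=
    fun e he j => ⟨by linarith [(hW₁ e he j).1], (hW₁ e he j).2⟩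
  -- (1) pull `F₂` through `Q` with the spectator `F₁ ∘ Θ₀`
  have hH1c : Continuous fun V : LGConfig 4 G => F₁ (cfgReflect V) := hF₁.comp continuous_cfgReflect
  have hH1b : ∀ V : LGConfig 4 G, |F₁ (cfgReflect V)| ≤ M₁ := fun V => hM₁ _
  have step1 := integral_mul_lift_eq_integral_mul_kerE G r β c b T lo hc' hF₂ hH1c hM₂ hH1b hS₂
    (isCylinder_comp_cfgReflect hS₁) hW₂ (hoff hW₁').1 (hoff hW₁').2
  -- (3) pull `F₁` through `Q` with the spectator `kerE_Q(F₂) ∘ Θ₀`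
  have hkc : Continuous fun η => kerE G r β c b η F₂ := continuous_kerE G r β c b hF₂ hM₂
  have hkb : ∀ η, |kerE G r β c b η F₂| ≤ M₂ := fun η => abs_kerE_le G r β c b η hM₂
  have hH2c : Continuous fun V : LGConfig 4 G => kerE G r β c b (cfgReflect V) F₂ :=
    hkc.comp continuous_cfgReflect
  have hH2b : ∀ V : LGConfig 4 G, |kerE G r β c b (cfgReflect V) F₂| ≤ M₂ := fun V => hkb _
  have hkS := isCylinder_comp_cfgReflect (isCylinder_kerE G r β c b hF₂.measurable hS₂)
  have step3 := integral_mul_lift_eq_integral_mul_kerE G r β c b T lo hc' hF₁ hH2c hM₁ hH2b hS₁ hkS hW₁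
    (hoff fun e he => kerE_supp_window hW₂ he).1 (hoff fun e he => kerE_supp_window hW₂ he).2
  -- (2), (4): reflections
  simp only [← torusLift_negReflect] at step1 step3
  have step2 := integral_comp_negReflect_eq (d := 4) (L := T) r.ρ r.continuous β
    (fun U => F₁ (torusLift T U) * kerE G r β c b (torusLift T U.negReflect) F₂)
  have step4 := integral_comp_negReflect_eq (d := 4) (L := T) r.ρ r.continuous β
    (fun U => kerE G r β c b (torusLift T U) F₂ * kerE G r β c b (torusLift T U.negReflect) F₁)
  simp only [WilsonSiteRP.negReflect_negReflect_config] at step2 step4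
  calc ∫ U, F₁ (torusLift T U.negReflect) * F₂ (torusLift T U) ∂(wilsonMeasure (d := 4) (L := T) r.ρ β)
      = ∫ U, F₁ (torusLift T U.negReflect) * kerE G r β c b (torusLift T U) F₂
          ∂(wilsonMeasure (d := 4) (L := T) r.ρ β) := step1
    _ = ∫ U, F₁ (torusLift T U) * kerE G r β c b (torusLift T U.negReflect) F₂
          ∂(wilsonMeasure (d := 4) (L := T) r.ρ β) := step2
    _ = ∫ U, kerE G r β c b (torusLift T U.negReflect) F₂ * F₁ (torusLift T U)
          ∂(wilsonMeasure (d := 4) (L := T) r.ρ β) := integral_congr_ae (ae_of_all _ fun U => mul_comm _ _)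
    _ = ∫ U, kerE G r β c b (torusLift T U.negReflect) F₂ * kerE G r β c b (torusLift T U) F₁
          ∂(wilsonMeasure (d := 4) (L := T) r.ρ β) := step3
    _ = ∫ U, kerE G r β c b (torusLift T U) F₂ * kerE G r β c b (torusLift T U.negReflect) F₁
          ∂(wilsonMeasure (d := 4) (L := T) r.ρ β) := step4
    _ = _ := integral_congr_ae (ae_of_all _ fun U => mul_comm _ _)

/-- **Mirror factorisation, covariance form on odd tori** (`torusE` vocabulary; `Θ₀ = cfgReflect`).  A cube
`Q = (c, b)` with `1 ≤ c 0`, `c 0 + b + 3 ≤ L`, `−L + 2 ≤ c j`, `c j + b + 2 ≤ L + 1`, and `F₁`, `F₂` bounded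
continuous cylinder observables with links based in `[c, c + b]`.  Then on the torus of side `2L+1`
`Cov_T(F₁∘Θ₀, F₂) = Cov_T(kerE_Q(F₁)∘Θ₀, kerE_Q(F₂))` (all read through the periodic lift): the mirror two-point
function of the pair IS the mirror covariance of the one-point boundary responses.  With `F₁ = F₂` and reflection
positivity this is the squared Osterwalder–Schrader seminorm `‖kerE_Q(F)∘lift‖²_OS` of card E. [folklore] -/
theorem torusCov_reflect_lift_eq_torusCov_reflect_kerE (β : ℝ) (c : Fin 4 → ℤ) (b L : ℕ) (hc0 : 1 ≤ c 0)
    (hcL : c 0 + (b : ℤ) + 3 ≤ L) (hc : ∀ j, -(L : ℤ) + 2 ≤ c j ∧ c j + (b : ℤ) + 2 ≤ (L : ℤ) + 1)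
    {F₁ F₂ : LGConfig 4 G → ℝ} (hF₁ : Continuous F₁) (hF₂ : Continuous F₂) {M₁ M₂ : ℝ}
    (hM₁ : ∀ U, |F₁ U| ≤ M₁) (hM₂ : ∀ U, |F₂ U| ≤ M₂)
    {S₁ S₂ : Finset (Literature.MathematicalPhysics.QuantumLattice.ZdEdge 4)}
    (hS₁ : IsCylinder F₁ S₁) (hS₂ : IsCylinder F₂ S₂)
    (hW₁ : ∀ e ∈ S₁, ∀ j, c j ≤ e.1 j ∧ e.1 j ≤ c j + b)
    (hW₂ : ∀ e ∈ S₂, ∀ j, c j ≤ e.1 j ∧ e.1 j ≤ c j + b) :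
    torusE G r β L (fun V => F₁ (cfgReflect V) * F₂ V) -
        torusE G r β L (fun V => F₁ (cfgReflect V)) * torusE G r β L F₂ =
      torusE G r β L (fun η => kerE G r β c b (cfgReflect η) F₁ * kerE G r β c b η F₂) -
        torusE G r β L (fun η => kerE G r β c b (cfgReflect η) F₁) *
          torusE G r β L (fun η => kerE G r β c b η F₂) := by
  have hT : b + 3 ≤ 2 * L + 1 := by have := hc 0; omega
  have hw : ∀ j, (fun _ : Fin 4 => -(L : ℤ)) j + 2 ≤ c j ∧ c j + (b : ℤ) + 2 ≤ (fun _ : Fin 4 => -(L : ℤ)) j + (2 * L + 1 : ℕ) :=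
    fun j => ⟨(hc j).1, by push_cast; linarith [(hc j).2]⟩
  have hlo : (fun _ : Fin 4 => -(L : ℤ)) 0 + c 0 + (b : ℤ) + 3 ≤ 0 := by simp only; linarith
  -- the product term
  have hprod := integral_reflect_lift_mul_lift_eq G r β c b (2 * L + 1) (fun _ => -(L : ℤ)) hc0 hw hlo hF₁ hF₂ hM₁
    hM₂ hS₁ hS₂ hW₁ hW₂
  -- the means
  have hm₁ : ∫ U, F₁ (torusLift (2 * L + 1) U.negReflect) ∂(wilsonMeasure (d := 4) (L := 2 * L + 1) r.ρ β) =
      ∫ U, kerE G r β c b (torusLift (2 * L + 1) U.negReflect) F₁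
        ∂(wilsonMeasure (d := 4) (L := 2 * L + 1) r.ρ β) := by
    rw [integral_comp_negReflect_eq (d := 4) (L := 2 * L + 1) r.ρ r.continuous β
        (fun U => F₁ (torusLift (2 * L + 1) U)),
      integral_comp_negReflect_eq (d := 4) (L := 2 * L + 1) r.ρ r.continuous β
        (fun U => kerE G r β c b (torusLift (2 * L + 1) U) F₁)]
    exact integral_lift_eq_integral_kerE_cube G r β c b (2 * L + 1) hT hF₁ hM₁ hS₁ hW₁
  have hm₂ := integral_lift_eq_integral_kerE_cube G r β c b (2 * L + 1) hT hF₂ hM₂ hS₂ hW₂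
  unfold torusE
  simp only [torusLift_negReflect] at hprod hm₁
  rw [hprod, hm₁, hm₂]

end Reflect

end Summit.QuantumFields.YangMills.Cruxes.NT.MarkovMirror

end
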